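import Literature.NumberTheory.Automorphic.EisensteinPackets
import Literature.NumberTheory.Automorphic.EisensteinSpectralProjection
import Literature.NumberTheory.Automorphic.ModularPretraceFromParseval

/-!
# The Parseval identity of `L²(SL₂(ℤ)\ℍ)` (Iwaniec, Theorems 4.7 & 7.3) and Theorem 7.4 for `SL₂(ℤ)`
(Iwaniec, *Spectral Methods of Automorphic Forms*, GSM 53, Prop. 7.1, Thm 7.3 (7.11)–(7.15), §7.4,
PDF pp. 69–76)

Final layer of the `provefact` decomposition of
`Literature.NumberTheory.Automorphic.Iwaniec2002_thm_7_4_modular` (`ModularPretrace.lean`).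
`ModularPretraceFromParseval.lean` reduced Theorem 7.4 for the modular group to the hypothesis
`∀ f, IsFdTest f → HasModularParseval f` — the Parseval identity
`‖f‖² = (3/π)|∫_𝒟 f|² + ‖P_𝓒 f‖² + (1/4π) ∫ |⟨E(·, ½ + ir), f⟩|² dr` for test functions on `𝒟`;
`EisensteinSpectralProjection.lean` proved the isometry identity for finite combinations `β` of
incomplete Eisenstein series (`⟨P_𝓔 β₁, P_𝓔 β₂⟩ = (1/4π) ∫ conj ℰβ₁ ℰβ₂`) and the density of the
`P_𝓔 E(·|ψ)` in the Eisenstein subspace `𝓔₀ = (ℂ·1 ⊔ 𝓒)ᗮ`; `EisensteinPackets.lean` provides the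
wave packets `E_g = ∫ g(r) E(·, ½ + ir) dr ∈ L²(𝒟)`, their pairing formula and their orthogonality
to `1` and `𝓒`. This file proves the hypothesis (`hasModularParseval`) and hence
**`Iwaniec2002_thm_7_4_modular_holds`** (everything PROVED, no new facts):

1. (§1) Bookkeeping for combinations (`EisCombo.zero/smul/add/single` and their classes, `ℰβ ∈ L²`,
   `eisCoef β.fn = ℰβ`), so that `projSpan = {P_𝓔 β}` is a subspace.
2. (§2) `𝓔₀ ≤ closure projSpan` (`eisSubspace_le_closure_projSpan`, from the density theorem: an
   element of `projSpanᗮ` has `P_𝓔 y = 0`), hence every `x ∈ 𝓔₀` is a limit of `P_𝓔 β_n`.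
3. (§3) Wave packets as elements of `L²(𝒟)`: `⟨1, E_g⟩ = 0`, `E_g ⊥ 𝓒` (tested on a Hilbert basis
   of Maass cusp forms), `⟨E_g, φ⟩ = ∫ conj(g) ⟨φ, E_r⟩ dr` for bounded `φ`.
4. (§4) **`hasModularParseval`** by approximation (no extension operator): for a test function `f`,
   `[f] = a·1 + P_𝓒[f] + f₃` with `f₃ ∈ 𝓔₀`, `‖[f]‖² = (3/π)|∫f|² + ‖P_𝓒 f‖² + ‖f₃‖²`; `f₃ = lim P_𝓔 β_n`;
   by the isometry `‖P_𝓔β_n − P_𝓔β_m‖² = (1/4π)‖ℰβ_n − ℰβ_m‖²` the coefficients form a Cauchy sequence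
   in `L²(ℝ)` with limit `G` and `‖f₃‖² = (1/4π)‖G‖²`; pairing with the packets of `g = 𝟙_K`
   (`⟨E_g, P_𝓔β_n⟩ = ⟨g, ℰβ_n⟩ → ⟨E_g, f₃⟩ = ⟨E_g, f⟩ = ∫_K ℰ_f`) gives `∫_K G = ∫_K ℰ_f` for every
   compact `K`, so `G = ℰ_f` a.e. (`ae_eq_zero_of_forall_setIntegral_isCompact_eq_zero'`), whence
   `ℰ_f ∈ L²` and the identity.
5. (§5) `Iwaniec2002_thm_7_4_modular_holds`, and the now unconditional (12.5)
   (`Iwaniec2002_eq_12_5_modular_holds`) and Selberg's lattice-point theorem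
   (`sl2BallCount_asymp_holds`) for the modular group, from the `_of_parseval` corollaries of
   `ModularPretraceFromParseval.lean`.

## References
* [Iwaniec2002] H. Iwaniec, *Spectral Methods of Automorphic Forms*, 2nd ed., GSM 53, AMS 2002,
  Prop. 7.1, PDF pp. 69–71; Thm 7.3 & (7.11)–(7.15), PDF pp. 74–75; §7.4 Thm 7.4, PDF pp. 75–76;
  Thm 4.7, PDF p. 52; (3.26), PDF p. 47; Cor. 12.2, PDF p. 126.
-/

noncomputable section

namespace Literature.NumberTheory.Automorphic

open MeasureTheory Set Filter Real UpperHalfPlane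
open scoped _root_.Topology _root_.MatrixGroups _root_.ComplexConjugate _root_.NNReal _root_.ENNReal _root_.Modular

local notation "Γℤ" => (𝒮ℒ : Subgroup (GL (Fin 2) ℝ))
local notation "μ𝒟" => MeasureTheory.Measure.restrict (volume : Measure ℍ) (ModularGroup.fd)

attribute [local instance] isFiniteMeasure_restrict_fd

local notation "H𝒟" => MeasureTheory.Lp ℂ 2 (MeasureTheory.Measure.restrict (volume : Measure ℍ) (ModularGroup.fd))

open scoped _root_.InnerProductSpace

/-! ## 1. Algebra of finite combinations of incomplete Eisenstein series -/

namespace EisCombo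

variable (β β₁ β₂ : EisCombo) {ψ : ℝ → ℝ}

/-- The empty combination. [folklore] -/
def zero : EisCombo := ⟨0, Fin.elim0, fun i => i.elim0, fun i => i.elim0, Fin.elim0⟩

/-- Scaling a combination. [folklore] -/
def smul (a : ℂ) : EisCombo := ⟨β.n, β.ψ, β.smooth, β.nonneg, fun i => a * β.c i⟩

/-- Concatenating two combinations. [folklore] -/
def add : EisCombo :=
  ⟨β₁.n + β₂.n, Fin.append β₁.ψ β₂.ψ,
    fun i => by
      refine Fin.addCases (motive := fun i => IsSmoothBump (Fin.append β₁.ψ β₂.ψ i)) (fun i => ?_) (fun i => ?_) i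
      · rw [Fin.append_left]; exact β₁.smooth i
      · rw [Fin.append_right]; exact β₂.smooth i,
    fun i t => by
      refine Fin.addCases (motive := fun i => 0 ≤ Fin.append β₁.ψ β₂.ψ i t) (fun i => ?_) (fun i => ?_) i
      · rw [Fin.append_left]; exact β₁.nonneg i t
      · rw [Fin.append_right]; exact β₂.nonneg i t,
    Fin.append β₁.c β₂.c⟩

/-- A single generator `E(·|ψ)`. [folklore] -/
def single (hψ : IsSmoothBump ψ) (h0 : ∀ t, 0 ≤ ψ t) : EisCombo :=
  ⟨1, fun _ => ψ, fun _ => hψ, fun _ => h0, fun _ => 1⟩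

/-- The empty combination is the zero function. [folklore] -/
@[simp] theorem zero_fn : zero.fn = 0 := by funext w; simp [fn, zero]
/-- The empty combination has zero coefficients. [folklore] -/
@[simp] theorem zero_coeff : zero.coeff = 0 := by funext r; simp [coeff, zero]

/-- Scaling acts on the function. [folklore] -/
@[simp] theorem smul_fn (a : ℂ) : (β.smul a).fn = fun w => a * β.fn w := by
  funext w
  show (∑ i : Fin β.n, a * β.c i * ((incEisG (β.ψ i) w : ℝ) : ℂ)) = a * ∑ i : Fin β.n, β.c i * ((incEisG (β.ψ i) w : ℝ) : ℂ)
  rw [Finset.mul_sum]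
  exact Finset.sum_congr rfl fun i _ => by ring

/-- Scaling acts on the coefficients. [folklore] -/
@[simp] theorem smul_coeff (a : ℂ) : (β.smul a).coeff = fun r => a * β.coeff r := by
  funext r
  show (∑ i : Fin β.n, a * β.c i * eisCoeff (β.ψ i) r) = a * ∑ i : Fin β.n, β.c i * eisCoeff (β.ψ i) r
  rw [Finset.mul_sum]
  exact Finset.sum_congr rfl fun i _ => by ring

/-- Concatenation adds the functions. [folklore] -/
@[simp] theorem add_fn : (β₁.add β₂).fn = fun w => β₁.fn w + β₂.fn w := by
  funext w
  show (∑ i : Fin (β₁.n + β₂.n), Fin.append β₁.c β₂.c i * ((incEisG (Fin.append β₁.ψ β₂.ψ i) w : ℝ) : ℂ)) =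
    (∑ i : Fin β₁.n, β₁.c i * ((incEisG (β₁.ψ i) w : ℝ) : ℂ)) + ∑ i : Fin β₂.n, β₂.c i * ((incEisG (β₂.ψ i) w : ℝ) : ℂ)
  rw [Fin.sum_univ_add]
  simp only [Fin.append_left, Fin.append_right]

/-- Concatenation adds the coefficients. [folklore] -/
@[simp] theorem add_coeff : (β₁.add β₂).coeff = fun r => β₁.coeff r + β₂.coeff r := by
  funext r
  show (∑ i : Fin (β₁.n + β₂.n), Fin.append β₁.c β₂.c i * eisCoeff (Fin.append β₁.ψ β₂.ψ i) r) =
    (∑ i : Fin β₁.n, β₁.c i * eisCoeff (β₁.ψ i) r) + ∑ i : Fin β₂.n, β₂.c i * eisCoeff (β₂.ψ i) r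
  rw [Fin.sum_univ_add]
  simp only [Fin.append_left, Fin.append_right]

/-- The function of a single generator. [folklore] -/
@[simp] theorem single_fn (hψ : IsSmoothBump ψ) (h0 : ∀ t, 0 ≤ ψ t) :
    (single hψ h0).fn = fun w => ((incEisG ψ w : ℝ) : ℂ) := by
  funext w; simp [fn, single]

/-- The coefficients of a single generator. [folklore] -/
@[simp] theorem single_coeff (hψ : IsSmoothBump ψ) (h0 : ∀ t, 0 ≤ ψ t) : (single hψ h0).coeff = eisCoeff ψ := by
  funext r; simp [coeff, single]

/-- Two combinations with the same function have the same class. [folklore] -/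
theorem lp_eq_of_fn_ae {β β' : EisCombo} {v : H𝒟} (h : ⇑v =ᵐ[μ𝒟] β'.fn) (hfn : β.fn = β'.fn) : β.lp = v :=
  Lp.ext (β.lp_coeFn.trans (by rw [hfn]; exact h.symm))

/-- The empty combination has class `0`. [folklore] -/
theorem zero_lp : zero.lp = 0 :=
  Lp.ext (zero.lp_coeFn.trans (by rw [zero_fn]; exact (Lp.coeFn_zero ℂ 2 μ𝒟).symm))

/-- Scaling acts on the class. [folklore] -/
theorem smul_lp (a : ℂ) : (β.smul a).lp = a • β.lp := by
  refine Lp.ext ((β.smul a).lp_coeFn.trans ?_)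
  rw [smul_fn]
  filter_upwards [Lp.coeFn_smul a β.lp, β.lp_coeFn] with w h1 h2
  rw [h1, Pi.smul_apply, h2, smul_eq_mul]

/-- Concatenation adds the classes. [folklore] -/
theorem add_lp : (β₁.add β₂).lp = β₁.lp + β₂.lp := by
  refine Lp.ext ((β₁.add β₂).lp_coeFn.trans ?_)
  rw [add_fn]
  filter_upwards [Lp.coeFn_add β₁.lp β₂.lp, β₁.lp_coeFn, β₂.lp_coeFn] with w h1 h2 h3
  rw [h1, Pi.add_apply, h2, h3]

/-- The class of a single generator is `incEisLp`. [folklore] -/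
theorem single_lp (hψ : IsSmoothBump ψ) (h0 : ∀ t, 0 ≤ ψ t) : (single hψ h0).lp = incEisLp hψ.isBumpWeight := by
  refine Lp.ext ((single hψ h0).lp_coeFn.trans ?_)
  rw [single_fn]
  exact (incEisLp_coeFn hψ.isBumpWeight).symm

/-- `ℰβ ∈ L²(ℝ)`. [folklore] -/
theorem memLp_coeff : MemLp β.coeff 2 (volume : Measure ℝ) := by
  unfold coeff
  exact memLp_finsetSum _ fun i _ => ((β.smooth i).memLp_eisCoeff).const_mul (β.c i)

/-- `conj ℰβ₁ · ℰβ₂` is integrable. [folklore] -/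
theorem integrable_conj_coeff_mul : Integrable fun r : ℝ => conj (β₁.coeff r) * β₂.coeff r := by
  have e : (fun r : ℝ => conj (β₁.coeff r) * β₂.coeff r) =
      fun r => ∑ i, ∑ j, conj (β₁.c i) * β₂.c j * (conj (eisCoeff (β₁.ψ i) r) * eisCoeff (β₂.ψ j) r) := by
    funext r
    simp only [coeff, map_sum, map_mul, Finset.sum_mul_sum]
    refine Finset.sum_congr rfl fun i _ => Finset.sum_congr rfl fun j _ => by ring
  rw [e]
  refine integrable_finsetSum _ fun i _ => integrable_finsetSum _ fun j _ => ?_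
  exact (integrable_conj_eisCoeff_mul (β₁.smooth i) (β₂.smooth j)).const_mul _

end EisCombo

/-- Incomplete Eisenstein series of bump weights are test functions on `𝒟`. [cite: Iwaniec2002, §3.2, PDF p. 43] -/
theorem IsBumpWeight.isFdTest {ψ : ℝ → ℝ} (hψ : IsBumpWeight ψ) : IsFdTest fun w => ((incEisG ψ w : ℝ) : ℂ) := by
  obtain ⟨a, b, ha, hsupp⟩ := hψ.support
  obtain ⟨C, hC⟩ := hψ.exists_bound_fd
  refine ⟨(Complex.continuous_ofReal.comp hψ.continuous_incEisG).aestronglyMeasurable, ⟨C, fun z hz => ?_⟩,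
    ⟨max b a⁻¹ + 1, fun z _ hz => ?_⟩⟩
  · rw [Complex.norm_real, Real.norm_eq_abs]; exact hC z hz
  · rw [incEisG_eq_zero_of_im_gt ha hsupp (by linarith), Complex.ofReal_zero]

namespace EisCombo

variable (β : EisCombo)

/-- `β.fn` is a test function on `𝒟`. [folklore] -/
theorem isFdTest_fn : IsFdTest β.fn := by
  obtain ⟨C, hC⟩ := β.exists_bound_fn
  obtain ⟨Y, hY⟩ := β.exists_fn_eq_zero
  exact ⟨β.continuous_fn.aestronglyMeasurable, ⟨C, fun z _ => hC z⟩, ⟨Y + 1, fun z _ hz => hY z (by linarith)⟩⟩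

/-- `ℰβ(r) = ⟨β, E(·, ½ + ir)⟩`, i.e. `eisCoef β.fn = β.coeff`. [folklore] -/
theorem eisCoef_fn (r : ℝ) : eisCoef β.fn r = β.coeff r := by
  unfold eisCoef coeff eisCoeff
  have hint : ∀ i ∈ (Finset.univ : Finset (Fin β.n)),
      Integrable (fun z => β.c i * (conj (eisensteinCrit z r) * ((incEisG (β.ψ i) z : ℝ) : ℂ))) μ𝒟 := fun i _ =>
    ((β.bw i).isFdTest.continuous_mul (continuous_conj_eisensteinCrit r)).integrable.const_mul (β.c i)
  have e : ∀ z, β.fn z * conj (eisensteinCrit z r) =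
      ∑ i, β.c i * (conj (eisensteinCrit z r) * ((incEisG (β.ψ i) z : ℝ) : ℂ)) := by
    intro z; simp only [fn, Finset.sum_mul]; exact Finset.sum_congr rfl fun i _ => by ring
  simp_rw [e]
  rw [integral_finsetSum _ hint]
  refine Finset.sum_congr rfl fun i _ => ?_
  rw [integral_const_mul]
  congr 1
  exact integral_congr_ae (Eventually.of_forall fun z => mul_comm _ _)

end EisCombo

/-! ## 2. The projected span and its density in `𝓔₀` -/

section ProjSpan

local notation "P𝓔" => (eisSubspace.starProjection : H𝒟 →L[ℂ] H𝒟)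

/-- The subspace `{P_𝓔 β : β a finite combination of incomplete Eisenstein series}`. [folklore] -/
def projSpan : Submodule ℂ H𝒟 where
  carrier := {v | ∃ β : EisCombo, v = P𝓔 β.lp}
  zero_mem' := ⟨EisCombo.zero, by rw [EisCombo.zero_lp, map_zero]⟩
  add_mem' := by
    rintro _ _ ⟨β₁, rfl⟩ ⟨β₂, rfl⟩
    exact ⟨β₁.add β₂, by rw [EisCombo.add_lp, map_add]⟩
  smul_mem' := by
    rintro a _ ⟨β, rfl⟩
    exact ⟨β.smul a, by rw [EisCombo.smul_lp, map_smul]⟩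

/-- `P_𝓔 β ∈ projSpan`. [folklore] -/
theorem mem_projSpan (β : EisCombo) : P𝓔 β.lp ∈ projSpan := ⟨β, rfl⟩

/-- `P_𝓔 v ∈ 𝓔₀`. [folklore] -/
theorem starProjection_mem_eisSubspace (v : H𝒟) : P𝓔 v ∈ eisSubspace :=
  Submodule.starProjection_apply_mem eisSubspace v

/-- **`𝓔₀ ⊆ closure {P_𝓔 β}`** (from the density theorem of `EisensteinSpectralProjection.lean`).
[cite: Iwaniec2002, Thm 7.3 & Prop 7.1, PDF pp. 70, 75] -/
theorem eisSubspace_le_closure_projSpan : eisSubspace ≤ projSpan.topologicalClosure := by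
  intro x hx
  rw [← Submodule.orthogonal_orthogonal_eq_closure, Submodule.mem_orthogonal]
  intro y hy
  have hy' : ∀ β : EisCombo, ⟪P𝓔 β.lp, y⟫_ℂ = 0 := fun β => (Submodule.mem_orthogonal _ _).mp hy _ (mem_projSpan β)
  have hPy : P𝓔 y = 0 := by
    refine eq_zero_of_mem_eisSubspace_of_forall_inner_starProjection_eq_zero (starProjection_mem_eisSubspace y)
      fun ψ hψ hψ0 => ?_
    rw [← EisCombo.single_lp hψ hψ0, ← Submodule.inner_starProjection_left_eq_right,
      Submodule.starProjection_eq_self_iff.mpr (starProjection_mem_eisSubspace _)]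
    exact hy' _
  have h1 : ⟪y - P𝓔 y, x⟫_ℂ = 0 :=
    Submodule.inner_left_of_mem_orthogonal hx (Submodule.sub_starProjection_mem_orthogonal y)
  calc ⟪y, x⟫_ℂ = ⟪(y - P𝓔 y) + P𝓔 y, x⟫_ℂ := by rw [sub_add_cancel]
    _ = 0 := by rw [inner_add_left, h1, hPy, inner_zero_left, add_zero]

/-- Elements of `𝓔₀` are limits of sequences `P_𝓔 β_n`. [folklore] -/
theorem exists_seq_tendsto_of_mem_eisSubspace {x : H𝒟} (hx : x ∈ eisSubspace) :
    ∃ β : ℕ → EisCombo, Tendsto (fun n => P𝓔 (β n).lp) atTop (𝓝 x) := by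
  have hmem : x ∈ closure (projSpan : Set H𝒟) := by
    rw [← Submodule.topologicalClosure_coe]
    exact eisSubspace_le_closure_projSpan hx
  obtain ⟨v, hv, hvt⟩ := mem_closure_iff_seq_limit.mp hmem
  choose β hβ using hv
  exact ⟨β, by simpa only [← hβ] using hvt⟩

end ProjSpan

/-! ## 3. Wave packets in `L²(𝒟)` and their orthogonality -/

section Packets

variable {g : ℝ → ℂ} {M R : ℝ}

/-- The class of a wave packet in `L²(𝒟)`. [cite: Iwaniec2002, Prop. 7.1 (first claim), PDF p. 70] -/
def packetLp (hg : AEStronglyMeasurable g volume) (hM : ∀ r, ‖g r‖ ≤ M) (hR : ∀ r, R < |r| → g r = 0) : H𝒟 :=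
  (memLp_eisPacket hg hM hR).toLp (eisPacket g)

/-- The class of a wave packet is represented by the packet. [folklore] -/
theorem packetLp_coeFn (hg : AEStronglyMeasurable g volume) (hM : ∀ r, ‖g r‖ ≤ M) (hR : ∀ r, R < |r| → g r = 0) :
    ⇑(packetLp hg hM hR) =ᵐ[μ𝒟] eisPacket g :=
  MemLp.coeFn_toLp _

/-- `⟨1, E_g⟩ = 0`. [cite: Iwaniec2002, §7.1, PDF p. 71] -/
theorem inner_oneLp_packetLp (hg : AEStronglyMeasurable g volume) (hM : ∀ r, ‖g r‖ ≤ M)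
    (hR : ∀ r, R < |r| → g r = 0) : ⟪oneLp, packetLp hg hM hR⟫_ℂ = 0 := by
  rw [inner_oneLp_left, integral_congr_ae (packetLp_coeFn hg hM hR)]
  exact integral_fd_eisPacket hg hM hR

/-- `E_g ⊥ 𝓒`. [cite: Iwaniec2002, §7.1, PDF p. 71] -/
theorem inner_packetLp_eq_zero_of_mem_cuspSubmodule (hg : AEStronglyMeasurable g volume) (hM : ∀ r, ‖g r‖ ≤ M)
    (hR : ∀ r, R < |r| → g r = 0) {x : H𝒟} (hx : x ∈ cuspSubmodule) : ⟪x, packetLp hg hM hR⟫_ℂ = 0 := by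
  obtain ⟨s, b, _, hb, hmem⟩ := exists_hilbertBasis_maassCuspForms
  refine inner_eq_zero_of_forall_basis b hb _ (fun y hy => ?_) x hx
  obtain ⟨u, t, hu, huy, -⟩ := hmem y hy
  have hL2 := integrableOn_norm_sq_of_ae_eq _ huy
  rw [inner_eq_setIntegral huy (packetLp_coeFn hg hM hR)]
  by_cases hne : ∃ z, u z ≠ 0
  · obtain ⟨μ, -, -, him⟩ := hu.eigenvalue_ge hL2 hne
    exact integral_fd_conj_mul_eisPacket_eq_zero hu hL2 him hg hM hR
  · have h0 : ∀ z, u z = 0 := fun z => by by_contra h; exact hne ⟨z, h⟩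
    simp [h0]

/-- **The pairing of a wave packet with a bounded function**: `⟨E_g, φ⟩ = ∫ conj(g) ⟨φ, E_r⟩ dr`.
[cite: Iwaniec2002, §7.2, PDF p. 72] -/
theorem inner_packetLp_toLp (hg : AEStronglyMeasurable g volume) (hM : ∀ r, ‖g r‖ ≤ M)
    (hR : ∀ r, R < |r| → g r = 0) {φ : ℍ → ℂ} {B : ℝ} (hφ : AEStronglyMeasurable φ μ𝒟) (hB : ∀ z, ‖φ z‖ ≤ B)
    (hφ2 : MemLp φ 2 μ𝒟) :
    ⟪packetLp hg hM hR, hφ2.toLp φ⟫_ℂ = ∫ r, conj (g r) * eisCoef φ r := by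
  rw [packetLp, inner_toLp_toLp_eq_integral, ← integral_fd_mul_conj_eisPacket hφ hB hg hM hR]
  exact integral_congr_ae (Eventually.of_forall fun z => mul_comm _ _)

end Packets

/-! ## 4. The Parseval identity for test functions on `𝒟` -/

section Main

local notation "P𝓔" => (eisSubspace.starProjection : H𝒟 →L[ℂ] H𝒟)
local notation "P𝓒" => (cuspSubmodule.starProjection : H𝒟 →L[ℂ] H𝒟)

variable {f : ℍ → ℂ}

/-- `∫ conj(v) v = ∫ ‖v‖²` as a complex number. [folklore] -/
theorem integral_conj_mul_self_eq {X : Type*} [MeasurableSpace X] {μ : Measure X} (v : X → ℂ) :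
    ∫ x, conj (v x) * v x ∂μ = ((∫ x, ‖v x‖ ^ 2 ∂μ : ℝ) : ℂ) := by
  rw [Bessel.integral_norm_sq_eq]
  exact integral_congr_ae (Eventually.of_forall fun x => mul_comm _ _)

/-- **`‖P_𝓔 β₁ − P_𝓔 β₂‖² = (1/4π) ∫ |ℰβ₁ − ℰβ₂|²`** (the isometry on differences, by sesquilinearity).
[cite: Iwaniec2002, Prop. 7.1, PDF p. 70] -/
theorem norm_sq_starProjection_sub (β₁ β₂ : EisCombo) :
    ‖P𝓔 β₁.lp - P𝓔 β₂.lp‖ ^ 2 = 1 / (4 * π) * ∫ r : ℝ, ‖β₁.coeff r - β₂.coeff r‖ ^ 2 := by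
  have i11 := β₁.integrable_conj_coeff_mul β₁
  have i12 := β₁.integrable_conj_coeff_mul β₂
  have i21 := β₂.integrable_conj_coeff_mul β₁
  have i22 := β₂.integrable_conj_coeff_mul β₂
  have key : ⟪P𝓔 β₁.lp - P𝓔 β₂.lp, P𝓔 β₁.lp - P𝓔 β₂.lp⟫_ℂ =
      ((1 / (4 * π) : ℝ) : ℂ) * ∫ r : ℝ, conj (β₁.coeff r - β₂.coeff r) * (β₁.coeff r - β₂.coeff r) := by
    rw [inner_sub_left, inner_sub_right, inner_sub_right, EisCombo.inner_starProjection_lp,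
      EisCombo.inner_starProjection_lp, EisCombo.inner_starProjection_lp, EisCombo.inner_starProjection_lp]
    have e : ∫ r : ℝ, conj (β₁.coeff r - β₂.coeff r) * (β₁.coeff r - β₂.coeff r) =
        ((∫ r : ℝ, conj (β₁.coeff r) * β₁.coeff r) - ∫ r : ℝ, conj (β₁.coeff r) * β₂.coeff r) -
          ((∫ r : ℝ, conj (β₂.coeff r) * β₁.coeff r) - ∫ r : ℝ, conj (β₂.coeff r) * β₂.coeff r) := by
      have h1 : (fun r : ℝ => conj (β₁.coeff r - β₂.coeff r) * (β₁.coeff r - β₂.coeff r)) =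
          fun r => (conj (β₁.coeff r) * β₁.coeff r - conj (β₁.coeff r) * β₂.coeff r) -
            (conj (β₂.coeff r) * β₁.coeff r - conj (β₂.coeff r) * β₂.coeff r) := by
        funext r; simp only [map_sub]; ring
      rw [h1, integral_sub (i11.sub' i12) (i21.sub' i22), integral_sub i11 i12, integral_sub i21 i22]
    rw [e]; ring
  rw [← inner_self_eq_norm_sq (𝕜 := ℂ), key, integral_conj_mul_self_eq, ← Complex.ofReal_mul]
  simp only [RCLike.re_to_complex, Complex.ofReal_re]

/-- **The Parseval identity of `L²(SL₂(ℤ)\ℍ)` for test functions** (Theorems 4.7 and 7.3 of the book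
in the form required by `ModularPretraceFromParseval.lean`): for `f` measurable, bounded and
vanishing high in the cusp on `𝒟`, the Eisenstein coefficients `⟨E(·, ½ + ir), f⟩` are in `L²(ℝ)` and
`‖f‖² = (3/π)|∫_𝒟 f|² + ‖P_𝓒 f‖² + (1/4π) ∫ |⟨E(·, ½ + ir), f⟩|² dr`.
[cite: Iwaniec2002, Thm 7.3 (7.15) with Thm 4.7 (4.15) and (3.26), PDF pp. 47, 52, 75] -/
theorem hasModularParseval (hf : IsFdTest f) : HasModularParseval f := by
  -- the `𝒟`-truncation (globally bounded, same class, same coefficients)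
  set fD : ℍ → ℂ := (ModularGroup.fd).indicator f with hfDdef
  obtain ⟨B, hB⟩ := hf.bounded
  have hBD : ∀ z, ‖fD z‖ ≤ max B 0 := by
    intro z
    by_cases hz : z ∈ ModularGroup.fd
    · rw [hfDdef, indicator_of_mem hz]; exact (hB z hz).trans (le_max_left _ _)
    · rw [hfDdef, indicator_of_notMem hz, norm_zero]; exact le_max_right _ _
  have hfDm : AEStronglyMeasurable fD μ𝒟 := hf.aestronglyMeasurable.indicator measurableSet_modular_fd
  have hfD_ae : fD =ᵐ[μ𝒟] f := indicator_ae_eq_restrict measurableSet_modular_fd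
  have hcoefD : ∀ r, eisCoef fD r = eisenCoeff f r := by
    intro r
    unfold eisCoef eisenCoeff
    refine integral_congr_ae ?_
    filter_upwards [hfD_ae] with z hz
    rw [hz, mul_comm]
  have hcont : Continuous (eisenCoeff f) := by
    have := continuous_eisCoef hfDm hBD
    rwa [show eisCoef fD = eisenCoeff f from funext hcoefD] at this
  -- the class of `f` and its three orthogonal pieces
  have hf2 := hf.memLp_two
  set F : H𝒟 := hf2.toLp f with hFdef
  have h11 : ⟪(oneLp : H𝒟), oneLp⟫_ℂ = ((π / 3 : ℝ) : ℂ) := inner_oneLp_self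
  have hπ3 : ((π / 3 : ℝ) : ℂ) ≠ 0 := by
    have : (0 : ℝ) < π / 3 := by positivity
    exact_mod_cast this.ne'
  set a : ℂ := ⟪(oneLp : H𝒟), F⟫_ℂ / ((π / 3 : ℝ) : ℂ) with hadef
  set F₁ : H𝒟 := a • oneLp with hF₁
  set F₂ : H𝒟 := P𝓒 F with hF₂
  set F₃ : H𝒟 := F - F₁ - F₂ with hF₃
  have hF₂mem : F₂ ∈ cuspSubmodule := by
    rw [hF₂]; exact Submodule.starProjection_apply_mem cuspSubmodule F
  have h1F₂ : ⟪(oneLp : H𝒟), F₂⟫_ℂ = 0 := inner_oneLp_eq_zero_of_mem_cuspSubmodule hF₂mem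
  have hF₃mem : F₃ ∈ eisSubspace := by
    rw [mem_eisSubspace_iff]
    constructor
    · rw [hF₃, inner_sub_right, inner_sub_right, hF₁, inner_smul_right, h11, h1F₂, hadef, div_mul_cancel₀ _ hπ3]
      ring
    · intro x hx
      rw [hF₃, inner_sub_right, inner_sub_right, hF₁, inner_smul_right, inner_oneLp_eq_zero_of_mem_cuspSubmodule' hx,
        mul_zero, sub_zero, hF₂, ← Submodule.inner_starProjection_left_eq_right,
        Submodule.starProjection_eq_self_iff.mpr hx, sub_self]
  have h13 : ⟪F₁, F₃⟫_ℂ = 0 := by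
    rw [hF₁, inner_smul_left, ((mem_eisSubspace_iff F₃).mp hF₃mem).1, mul_zero]
  have h23 : ⟪F₂, F₃⟫_ℂ = 0 := ((mem_eisSubspace_iff F₃).mp hF₃mem).2 F₂ hF₂mem
  have h12 : ⟪F₁, F₂⟫_ℂ = 0 := by rw [hF₁, inner_smul_left, h1F₂, mul_zero]
  have hsplit : F = (F₁ + F₂) + F₃ := by rw [hF₃]; abel
  have hnorm : ‖F‖ ^ 2 = ‖F₁‖ ^ 2 + ‖F₂‖ ^ 2 + ‖F₃‖ ^ 2 := by
    have hA : ⟪F₁ + F₂, F₃⟫_ℂ = 0 := by rw [inner_add_left, h13, h23, add_zero]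
    have e1 := norm_add_sq_eq_norm_sq_add_norm_sq_of_inner_eq_zero (F₁ + F₂) F₃ hA
    have e2 := norm_add_sq_eq_norm_sq_add_norm_sq_of_inner_eq_zero F₁ F₂ h12
    rw [hsplit, pow_two, pow_two, pow_two, pow_two, e1, e2]
  -- `‖F₁‖² = (3/π)|∫ f|²`
  have hintf : ⟪(oneLp : H𝒟), F⟫_ℂ = ∫ z in ModularGroup.fd, f z := by
    rw [inner_oneLp_left]; exact integral_congr_ae hf2.coeFn_toLp
  have hone : ‖(oneLp : H𝒟)‖ ^ 2 = π / 3 := by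
    rw [← inner_self_eq_norm_sq (𝕜 := ℂ), h11]; norm_cast
  have hF₁norm : ‖F₁‖ ^ 2 = 3 / π * ‖∫ z in ModularGroup.fd, f z‖ ^ 2 := by
    rw [hF₁, norm_smul, mul_pow, hone, hadef, norm_div, hintf, Complex.norm_real, Real.norm_of_nonneg (by positivity)]
    field_simp
  -- approximation of `F₃` by projected combinations
  obtain ⟨β, hβ⟩ := exists_seq_tendsto_of_mem_eisSubspace hF₃mem
  set V : ℕ → H𝒟 := fun n => P𝓔 (β n).lp with hVdef
  set C : ℕ → Lp ℂ 2 (volume : Measure ℝ) := fun n => ((β n).memLp_coeff).toLp (β n).coeff with hCdef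
  have hCsub : ∀ n m, ‖C n - C m‖ ^ 2 = ∫ r, ‖(β n).coeff r - (β m).coeff r‖ ^ 2 := by
    intro n m
    rw [hCdef]
    simp only
    rw [← MemLp.toLp_sub, norm_toLp_sq_eq_integral]
    simp only [Pi.sub_apply]
  have hVV : ∀ n m, ‖V n - V m‖ ^ 2 = 1 / (4 * π) * ‖C n - C m‖ ^ 2 := by
    intro n m
    rw [hCsub, hVdef]
    exact norm_sq_starProjection_sub (β n) (β m)
  have hVc : CauchySeq V := hβ.cauchySeq
  have h4π : 0 < 4 * π := by positivity
  have hCc : CauchySeq C := by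
    rw [Metric.cauchySeq_iff] at hVc ⊢
    intro ε hε
    obtain ⟨N, hN⟩ := hVc (ε / Real.sqrt (4 * π)) (by positivity)
    refine ⟨N, fun n hn m hm => ?_⟩
    have hd : dist (C n) (C m) = Real.sqrt (4 * π) * dist (V n) (V m) := by
      rw [dist_eq_norm, dist_eq_norm]
      have h := hVV n m
      have h4 : ‖C n - C m‖ ^ 2 = (Real.sqrt (4 * π) * ‖V n - V m‖) ^ 2 := by
        rw [mul_pow, Real.sq_sqrt h4π.le, h]
        field_simp
      exact (pow_left_inj₀ (norm_nonneg _) (by positivity) two_ne_zero).mp h4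
    rw [hd]
    calc Real.sqrt (4 * π) * dist (V n) (V m) < Real.sqrt (4 * π) * (ε / Real.sqrt (4 * π)) :=
          mul_lt_mul_of_pos_left (hN n hn m hm) (by positivity)
      _ = ε := by field_simp
  obtain ⟨G, hG⟩ := cauchySeq_tendsto_of_complete hCc
  -- `‖F₃‖² = (1/4π) ‖G‖²`
  have hVn : ∀ n, ‖V n‖ ^ 2 = 1 / (4 * π) * ‖C n‖ ^ 2 := by
    intro n
    rw [hVdef, hCdef]
    simp only
    rw [EisCombo.norm_sq_starProjection_lp, norm_toLp_sq_eq_integral]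
  have hF₃norm : ‖F₃‖ ^ 2 = 1 / (4 * π) * ‖G‖ ^ 2 := by
    have t1 : Tendsto (fun n => ‖V n‖ ^ 2) atTop (𝓝 (‖F₃‖ ^ 2)) := (hβ.norm).pow 2
    have t2 : Tendsto (fun n => 1 / (4 * π) * ‖C n‖ ^ 2) atTop (𝓝 (1 / (4 * π) * ‖G‖ ^ 2)) :=
      ((hG.norm).pow 2).const_mul _
    exact tendsto_nhds_unique (t1.congr hVn) t2
  -- identification of `G` with `ℰ_f` on compact sets
  have hGloc : LocallyIntegrable (G : ℝ → ℂ) := (Lp.memLp G).locallyIntegrable (by norm_num)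
  have hGf : ∀ K : Set ℝ, IsCompact K → ∫ r in K, ((G : ℝ → ℂ) r - eisenCoeff f r) = 0 := by
    intro K hK
    obtain ⟨R, hR⟩ : ∃ R : ℝ, K ⊆ Icc (-R) R := by
      obtain ⟨R, hR⟩ := (Metric.isBounded_iff_subset_closedBall (0 : ℝ)).mp hK.isBounded
      refine ⟨R, fun r hr => ?_⟩
      have := hR hr
      rw [Metric.mem_closedBall, Real.dist_eq, sub_zero, abs_le] at this
      exact this
    set gK : ℝ → ℂ := K.indicator (fun _ => (1 : ℂ)) with hgK
    have hgm : AEStronglyMeasurable gK volume := aestronglyMeasurable_const.indicator hK.measurableSet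
    have hgM : ∀ r, ‖gK r‖ ≤ 1 := fun r => by
      rw [hgK]; by_cases h : r ∈ K
      · rw [indicator_of_mem h, norm_one]
      · rw [indicator_of_notMem h, norm_zero]; exact zero_le_one
    have hgR : ∀ r, R < |r| → gK r = 0 := fun r hr => by
      rw [hgK, indicator_of_notMem]
      intro h
      have := hR h
      rw [mem_Icc, ← abs_le] at this
      linarith
    have hind : ∀ X : ℝ → ℂ, (fun r => conj (gK r) * X r) = K.indicator X := by
      intro X; funext r
      by_cases h : r ∈ K
      · rw [hgK, indicator_of_mem h, indicator_of_mem h, map_one, one_mul]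
      · rw [hgK, indicator_of_notMem h, indicator_of_notMem h, map_zero, zero_mul]
    have hGK2 : MemLp gK 2 volume := memLp_two_profile hgm hgM hgR
    -- (a) `⟨W, V n⟩ = ⟨GK, C n⟩`
    have hWV : ∀ n, ⟪packetLp hgm hgM hgR, V n⟫_ℂ = ⟪hGK2.toLp gK, C n⟫_ℂ := by
      intro n
      obtain ⟨Bβ, hBβ⟩ := (β n).exists_bound_fn
      have hlp : (β n).lp = ((β n).isFdTest_fn.memLp_two).toLp (β n).fn :=
        Lp.ext (((β n).lp_coeFn).trans (MemLp.coeFn_toLp _).symm)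
      rw [hVdef]
      simp only
      rw [EisCombo.starProjection_lp, inner_sub_right, inner_smul_right, ← inner_conj_symm (packetLp hgm hgM hgR) oneLp,
        inner_oneLp_packetLp, map_zero, mul_zero, sub_zero, hlp,
        inner_packetLp_toLp hgm hgM hgR (β n).continuous_fn.aestronglyMeasurable hBβ]
      simp_rw [EisCombo.eisCoef_fn]
      rw [hCdef]
      simp only
      rw [inner_toLp_toLp_eq_integral]
    -- (b) limits
    have lim1 : Tendsto (fun n => ⟪packetLp hgm hgM hgR, V n⟫_ℂ) atTop (𝓝 ⟪packetLp hgm hgM hgR, F₃⟫_ℂ) := tendsto_const_nhds.inner hβ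
    have lim2 : Tendsto (fun n => ⟪hGK2.toLp gK, C n⟫_ℂ) atTop (𝓝 ⟪hGK2.toLp gK, G⟫_ℂ) := tendsto_const_nhds.inner hG
    have hEq : ⟪packetLp hgm hgM hgR, F₃⟫_ℂ = ⟪hGK2.toLp gK, G⟫_ℂ := tendsto_nhds_unique (lim1.congr hWV) lim2
    -- (c) `⟨W, F₃⟩ = ∫_K ℰ_f`
    have hfD2 : MemLp fD 2 μ𝒟 := hf2.ae_eq hfD_ae.symm
    have hFD : F = hfD2.toLp fD := (MemLp.toLp_eq_toLp_iff hf2 hfD2).mpr hfD_ae.symm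
    have hW1 : ⟪packetLp hgm hgM hgR, F₁⟫_ℂ = 0 := by
      rw [hF₁, inner_smul_right, ← inner_conj_symm (packetLp hgm hgM hgR) oneLp, inner_oneLp_packetLp, map_zero, mul_zero]
    have hW2 : ⟪packetLp hgm hgM hgR, F₂⟫_ℂ = 0 := by
      rw [← inner_conj_symm, inner_packetLp_eq_zero_of_mem_cuspSubmodule hgm hgM hgR hF₂mem, map_zero]
    have hWF₃ : ⟪packetLp hgm hgM hgR, F₃⟫_ℂ = ∫ r in K, eisenCoeff f r := by
      rw [hF₃, inner_sub_right, inner_sub_right, hW1, hW2, sub_zero, sub_zero, hFD,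
        inner_packetLp_toLp hgm hgM hgR hfDm hBD hfD2]
      simp_rw [hcoefD]
      rw [hind, integral_indicator hK.measurableSet]
    -- (d) `⟨GK, G⟩ = ∫_K G`
    have hGKG : ⟪hGK2.toLp gK, G⟫_ℂ = ∫ r in K, (G : ℝ → ℂ) r := by
      rw [L2.inner_def, ← integral_indicator hK.measurableSet, ← hind]
      refine integral_congr_ae ?_
      filter_upwards [hGK2.coeFn_toLp] with r hr
      rw [hr, RCLike.inner_apply, mul_comm]
    -- (e) conclusion on `K`
    have iG : IntegrableOn (G : ℝ → ℂ) K := hGloc.integrableOn_isCompact hK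
    have iE : IntegrableOn (eisenCoeff f) K := hcont.continuousOn.integrableOn_compact hK
    rw [integral_sub iG iE, ← hGKG, ← hWF₃, hEq, sub_self]
  have hEloc : LocallyIntegrable (eisenCoeff f) := hcont.locallyIntegrable
  have hae : (fun r => (G : ℝ → ℂ) r - eisenCoeff f r) =ᵐ[volume] 0 :=
    ae_eq_zero_of_forall_setIntegral_isCompact_eq_zero' (hGloc.sub hEloc) hGf
  have hGE : (G : ℝ → ℂ) =ᵐ[volume] eisenCoeff f := by
    filter_upwards [hae] with r hr
    rwa [Pi.zero_apply, sub_eq_zero] at hr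
  have hEmem : MemLp (eisenCoeff f) 2 volume := (Lp.memLp G).ae_eq hGE
  have hGnorm : ‖G‖ ^ 2 = ∫ r, ‖eisenCoeff f r‖ ^ 2 := by
    have : G = hEmem.toLp (eisenCoeff f) := Lp.ext (hGE.trans (MemLp.coeFn_toLp _).symm)
    rw [this, norm_toLp_sq_eq_integral]
  -- assemble
  refine ⟨hEmem, fun hf2' => ?_⟩
  have hFF : hf2'.toLp f = F := rfl
  rw [hFF, ← norm_toLp_sq_eq_integral hf2, ← hFdef, hnorm, hF₁norm, hF₃norm, hGnorm, hF₂,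
    Submodule.starProjection_apply, ← Submodule.coe_norm]

end Main

/-! ## 5. Theorem 7.4 for the modular group, and its corollaries, unconditionally -/

/-- **Iwaniec's Theorem 7.4 (with Proposition 7.2) for `SL₂(ℤ)`, discharged**: the named fact
`Iwaniec2002_thm_7_4_modular` of `ModularPretrace.lean` holds. [cite: Iwaniec2002, Thm 7.4 (7.17) & Prop 7.2 (7.10), PDF pp. 71–76] -/
theorem Iwaniec2002_thm_7_4_modular_holds : Iwaniec2002_thm_7_4_modular :=
  Iwaniec2002_thm_7_4_modular_of_parseval fun _ hf => hasModularParseval hf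

/-- **The pretrace estimate (12.5) for `SL₂(ℤ)`, discharged.** [cite: Iwaniec2002, (12.5), PDF p. 125] -/
theorem Iwaniec2002_eq_12_5_modular_holds : Iwaniec2002_eq_12_5_modular :=
  Iwaniec2002_eq_12_5_modular_of_parseval fun _ hf => hasModularParseval hf

/-- **Selberg's hyperbolic lattice-point theorem for `SL₂(ℤ)`** (Corollary 12.2), unconditionally.
[cite: Iwaniec2002, Cor. 12.2, PDF p. 126] -/
theorem sl2BallCount_asymp_holds : sl2BallCount_asymp :=
  sl2BallCount_asymp_of_parseval fun _ hf => hasModularParseval hf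

end Literature.NumberTheory.Automorphic

end
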